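import Literature.AlgebraicGeometry.Motives.MixedHodgeStructureInternalHomFiltrations
import HarnessLib

/-!
# Evaluation, composition and the duality pairing as morphisms of mixed Hodge structures

With the printed filtrations of the internal Hom of mixed `ℚ`-Hodge structures available
(`Motives/MixedHodgeStructureInternalHomFiltrations`: `W_r Hom(H₁, H₂) = {f | f(W_n) ⊆ W_{n+r}}`,
`F^p Hom(H₁, H₂)_ℂ = {φ | φ(F^n) ⊆ F^{n+p}}`; Deligne, *Hodge II*, 1.1.12; El Zein–Lê, Ch. 3 of
Cattani–El Zein–Griffiths–Lê, §3.2.2.7 (2)), the structure maps of the closed tensor structure are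
morphisms of MHS "given by the usual constructions" on the underlying vector spaces — Deligne
1.1.12: "Ces constructions sont compatibles à la composition des foncteurs", `Hom` and `⊗` being
functors of filtered objects; for the Tannakian formalism (internal Hom with its evaluation
`ev : Hom(X, Y) ⊗ X → Y`, Deligne–Milne, *Tannakian categories*, §1 Def. 1.6, (1.6.2)–(1.6.4)) this
is what makes `MixedHodgeStructure.hom` THE internal Hom of the tensor category of MHS — the
tensor–Hom adjunction `Hom_MHS(T ⊗ H₁, H₂) ≃ Hom_MHS(T, Hom(H₁, H₂))` (`tensorHomEquiv`, Def. 1.6: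
"`Hom(X, Y)` [is] the representing object" of `T ↦ Hom(T ⊗ X, Y)`):

* **`homEval H₁ H₂ : Hom (Hom(H₁, H₂) ⊗ H₁) H₂`**, `f ⊗ v ↦ f v` — `W_r Hom ⊗ W_k H₁ → W_{k+r} H₂` and
  `F^a Hom ⊗ F^c H₁ → F^{a+c} H₂` by the very description of the filtrations of `Hom`;
* **`homComp : Hom (Hom(H₂, H₃) ⊗ Hom(H₁, H₂)) Hom(H₁, H₃)`**, `g ⊗ f ↦ g ∘ f`;
* **`curryHom`, `uncurryHom`, `tensorHomEquiv : Hom (T ⊗ H₁) H₂ ≃ Hom T (Hom(H₁, H₂))`** — the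
  internal Hom represents `T ↦ Hom_MHS(T ⊗ H₁, H₂)` (Deligne–Milne Def. 1.6);
* **`dualPairing H : Hom (H^∨ ⊗ H) ℚ(0)`**, `φ ⊗ v ↦ φ(v)` — the duality pairing
  (`W_i(H^∨) ⊗ W_k H = (W_{-i-1})^⊥ ⊗ W_k` pairs to `0` when `i + k < 0`; `(F^{1-a})^⊥ ⊗ F^c` pairs to
  `0` when `a + c > 0`), with values in the unit object `ℚ(0)` (the tree's
  `(HodgeStructure.tate 0).toMixedHodgeStructure`, `W_{-1} = 0 ⊂ W_0 = ℚ`, `F⁰ = ℂ ⊃ F¹ = 0`).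

All are definitions with bodies (morphisms of MHS) plus `rfl`-level evaluation lemmas; no named
fact is introduced.

## References

* [DeligneHodgeII1971] P. Deligne, Théorie de Hodge II, 1.1.6, 1.1.12 (pp. 7–9), 2.3.1.
* [CattaniElZeinGriffithsLe2014] E. Cattani et al. (eds.), Hodge Theory (2014), Ch. 3 §3.2.2.7.
* [DeligneMilne1982Tannakian] P. Deligne, J. S. Milne, Tannakian categories, in LNM 900 (1982),
  §1, Def. 1.6 and (1.6.2)–(1.6.4) (internal Hom, `ev`, composition; held text
  `book:deligne1982-hodge-cycles-motives-shimura-varieties`, p. 84: "in `Mod_R`,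
  `Hom(X, Y) = Hom_R(X, Y)` regarded as an `R`-module, and `ev` is `f ⊗ x ↦ f(x)`").
-/

noncomputable section

open scoped TensorProduct

namespace Literature.AlgebraicGeometry.Motives

namespace MixedHodgeStructure

universe u v w

variable {V : Type u} [AddCommGroup V] [Module ℚ V]
variable {V' : Type v} [AddCommGroup V'] [Module ℚ V']
variable {V'' : Type w} [AddCommGroup V''] [Module ℚ V'']

open Module
open HodgeStructure (homBaseChange homBaseChange_tmul dualBaseChange dualBaseChange_tmul_tmul
  tensorBaseChange tensorBaseChange_tmul)

/-! ### Comparison squares under complexification -/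

/-- Evaluation commutes with complexification: `(ev)_ℂ = ev_ℂ ∘ (homBaseChange ⊗ id) ∘ tensorBaseChange`
(on `c ⊗ (f ⊗ v)` both sides give `c ⊗ f(v)`). [folklore] -/
private theorem eval_baseChange (Z : ℂ ⊗[ℚ] ((V →ₗ[ℚ] V') ⊗[ℚ] V)) :
    (TensorProduct.lift (LinearMap.id : (V →ₗ[ℚ] V') →ₗ[ℚ] (V →ₗ[ℚ] V'))).baseChange ℂ Z =
      TensorProduct.lift (LinearMap.id : (ℂ ⊗[ℚ] V →ₗ[ℂ] ℂ ⊗[ℚ] V') →ₗ[ℂ] (ℂ ⊗[ℚ] V →ₗ[ℂ] ℂ ⊗[ℚ] V'))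
        (TensorProduct.map (homBaseChange V V') LinearMap.id
          (tensorBaseChange (V →ₗ[ℚ] V') V Z)) := by
  induction Z using TensorProduct.induction_on with
  | zero => simp only [map_zero]
  | add x y hx hy => simp only [map_add, hx, hy]
  | tmul c t =>
    induction t using TensorProduct.induction_on with
    | zero => simp only [TensorProduct.tmul_zero, map_zero]
    | add x y hx hy => simp only [TensorProduct.tmul_add, map_add, hx, hy]
    | tmul f v =>
      rw [LinearMap.baseChange_tmul, TensorProduct.lift.tmul, LinearMap.id_apply, tensorBaseChange_tmul,
        TensorProduct.map_tmul, LinearMap.id_apply, homBaseChange_tmul, TensorProduct.lift.tmul,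
        LinearMap.id_apply, LinearMap.smul_apply, LinearMap.baseChange_tmul, TensorProduct.smul_tmul',
        smul_eq_mul, mul_one]

/-- Composition commutes with complexification:
`homBaseChange ((∘)_ℂ Z) = (∘_ℂ) ((homBaseChange ⊗ homBaseChange) (tensorBaseChange Z))`
(on `c ⊗ (g ⊗ f)` both sides give `c • g_ℂ ∘ f_ℂ`). [folklore] -/
private theorem homBaseChange_comp_baseChange (Z : ℂ ⊗[ℚ] ((V' →ₗ[ℚ] V'') ⊗[ℚ] (V →ₗ[ℚ] V'))) :
    homBaseChange V V'' ((TensorProduct.lift (LinearMap.llcomp ℚ V V' V'')).baseChange ℂ Z) =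
      TensorProduct.lift (LinearMap.llcomp ℂ (ℂ ⊗[ℚ] V) (ℂ ⊗[ℚ] V') (ℂ ⊗[ℚ] V''))
        (TensorProduct.map (homBaseChange V' V'') (homBaseChange V V')
          (tensorBaseChange (V' →ₗ[ℚ] V'') (V →ₗ[ℚ] V') Z)) := by
  induction Z using TensorProduct.induction_on with
  | zero => simp only [map_zero]
  | add x y hx hy => simp only [map_add, hx, hy]
  | tmul c t =>
    induction t using TensorProduct.induction_on with
    | zero => simp only [TensorProduct.tmul_zero, map_zero]
    | add x y hx hy => simp only [TensorProduct.tmul_add, map_add, hx, hy]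
    | tmul g f =>
      rw [LinearMap.baseChange_tmul, TensorProduct.lift.tmul, LinearMap.llcomp_apply', homBaseChange_tmul,
        LinearMap.baseChange_comp, tensorBaseChange_tmul, TensorProduct.map_tmul, homBaseChange_tmul,
        homBaseChange_tmul, one_smul, TensorProduct.lift.tmul, LinearMap.llcomp_apply', LinearMap.smul_comp]

/-- The duality pairing commutes with complexification: `⟨·,·⟩_ℂ Z = (⟨·,·⟩ over ℂ of
(dualBaseChange ⊗ id)(tensorBaseChange Z)) ⊗ 1` (on `c ⊗ (φ ⊗ v)` both sides give `c ⊗ φ(v)`).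
[folklore] -/
private theorem contractLeft_baseChange (Z : ℂ ⊗[ℚ] (Module.Dual ℚ V ⊗[ℚ] V)) :
    (contractLeft ℚ V).baseChange ℂ Z =
      (TensorProduct.mk ℚ ℂ ℚ).flip 1 (contractLeft ℂ (ℂ ⊗[ℚ] V)
        (TensorProduct.map (dualBaseChange V) LinearMap.id (tensorBaseChange (Module.Dual ℚ V) V Z))) := by
  induction Z using TensorProduct.induction_on with
  | zero => simp only [map_zero]
  | add x y hx hy => simp only [map_add, hx, hy]
  | tmul c t =>
    induction t using TensorProduct.induction_on with
    | zero => simp only [TensorProduct.tmul_zero, map_zero]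
    | add x y hx hy => simp only [TensorProduct.tmul_add, map_add, hx, hy]
    | tmul φ v =>
      rw [LinearMap.baseChange_tmul, contractLeft_apply, tensorBaseChange_tmul, TensorProduct.map_tmul,
        LinearMap.id_apply, contractLeft_apply, dualBaseChange_tmul_tmul, LinearMap.flip_apply,
        TensorProduct.mk_apply, mul_smul_comm, mul_one, TensorProduct.smul_tmul, smul_eq_mul, mul_one]

/-- Comparison: for `g : T ⊗ V → V'`, `τ ∈ T_ℂ`, `x ∈ V_ℂ`,
`homBaseChange ((curry g)_ℂ τ) x = g_ℂ (tensorBaseChange⁻¹ (τ ⊗ x))` (on `τ = c ⊗ t`, `x = d ⊗ v` both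
sides are `(c d) ⊗ g(t ⊗ v)`). [folklore] -/
private theorem homBaseChange_curry_baseChange {T : Type*} [AddCommGroup T] [Module ℚ T]
    (g : T ⊗[ℚ] V →ₗ[ℚ] V') (τ : ℂ ⊗[ℚ] T) (x : ℂ ⊗[ℚ] V) :
    homBaseChange V V' ((TensorProduct.curry g).baseChange ℂ τ) x =
      g.baseChange ℂ ((tensorBaseChange T V).symm (τ ⊗ₜ[ℂ] x)) := by
  induction τ using TensorProduct.induction_on with
  | zero => simp only [map_zero, LinearMap.zero_apply, TensorProduct.zero_tmul]
  | add τ₁ τ₂ h₁ h₂ => simp only [map_add, LinearMap.add_apply, TensorProduct.add_tmul, h₁, h₂]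
  | tmul c t =>
    induction x using TensorProduct.induction_on with
    | zero => simp only [map_zero, TensorProduct.tmul_zero]
    | add x y hx hy => simp only [map_add, TensorProduct.tmul_add, hx, hy]
    | tmul d v =>
      have h : (c ⊗ₜ[ℚ] t : ℂ ⊗[ℚ] T) ⊗ₜ[ℂ] (d ⊗ₜ[ℚ] v : ℂ ⊗[ℚ] V) =
          tensorBaseChange T V ((d * c) ⊗ₜ[ℚ] (t ⊗ₜ[ℚ] v)) := by
        rw [tensorBaseChange_tmul, show (d ⊗ₜ[ℚ] v : ℂ ⊗[ℚ] V) = d • ((1 : ℂ) ⊗ₜ[ℚ] v) by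
          rw [TensorProduct.smul_tmul', smul_eq_mul, mul_one], TensorProduct.tmul_smul,
          TensorProduct.smul_tmul', TensorProduct.smul_tmul', smul_eq_mul]
      rw [h, LinearEquiv.symm_apply_apply, LinearMap.baseChange_tmul, homBaseChange_tmul,
        LinearMap.smul_apply, LinearMap.baseChange_tmul, TensorProduct.curry_apply,
        LinearMap.baseChange_tmul, TensorProduct.smul_tmul', smul_eq_mul, mul_comm]

variable [FiniteDimensional ℚ V] [FiniteDimensional ℚ V'] [FiniteDimensional ℚ V'']
  (H₁ : MixedHodgeStructure V) (H₂ : MixedHodgeStructure V') (H₃ : MixedHodgeStructure V'')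

/-! ### Evaluation -/

/-- **The evaluation `Hom(H₁, H₂) ⊗ H₁ → H₂`, `f ⊗ v ↦ f(v)`, is a morphism of mixed Hodge
structures**: `W_r Hom ⊗ W_k H₁ ↦ f(W_k) ⊆ W_{k+r} H₂` and `F^a Hom_ℂ ⊗ F^c H₁ ↦ φ(F^c) ⊆ F^{c+a} H₂`
by the description of the filtrations of the internal Hom (Deligne, Hodge II, 1.1.12; El Zein–Lê
§3.2.2.7 (2)) — the evaluation `ev` of the internal Hom of the tensor category of MHS (Deligne–Milne,
Def. 1.6: "in `Mod_R` … `ev` is `f ⊗ x ↦ f(x)`"). [cite: DeligneHodgeII1971, 1.1.12]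
[cite: DeligneMilne1982Tannakian, §1 Def. 1.6] -/
def homEval : Hom (tensor (hom H₁ H₂) H₁) H₂ where
  toLinearMap := TensorProduct.lift LinearMap.id
  map_W_le n := by
    rw [tensor_W, Submodule.map_le_iff_le_comap]
    refine iSup₂_le fun ij (hij : ij.1 + ij.2 = n) ↦ Submodule.map₂_le.2 fun f hf v hv ↦ ?_
    rw [mem_hom_W_iff] at hf
    rw [Submodule.mem_comap, TensorProduct.mk_apply, TensorProduct.lift.tmul, LinearMap.id_apply]
    exact H₂.monotone_W (show ij.2 + ij.1 ≤ n by omega) (hf ij.2 ⟨v, hv, rfl⟩)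
  map_F_le p := by
    rw [tensor_F, Submodule.map_le_iff_le_comap]
    refine iSup₂_le fun ac (hac : ac.1 + ac.2 = p) ↦ fun Z hZ ↦ ?_
    rw [Submodule.mem_comap] at hZ
    rw [Submodule.mem_comap, eval_baseChange]
    have hle : Submodule.map₂ (TensorProduct.mk ℂ (ℂ ⊗[ℚ] (V →ₗ[ℚ] V')) (ℂ ⊗[ℚ] V))
        ((hom H₁ H₂).F ac.1) (H₁.F ac.2) ≤ (H₂.F p).comap
          (TensorProduct.lift (LinearMap.id : (ℂ ⊗[ℚ] V →ₗ[ℂ] ℂ ⊗[ℚ] V') →ₗ[ℂ] _) ∘ₗ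
            TensorProduct.map (homBaseChange V V') LinearMap.id) := by
      refine Submodule.map₂_le.2 fun ξ hξ x hx ↦ ?_
      rw [mem_hom_F_iff] at hξ
      rw [Submodule.mem_comap, TensorProduct.mk_apply, LinearMap.comp_apply, TensorProduct.map_tmul,
        LinearMap.id_apply, TensorProduct.lift.tmul, LinearMap.id_apply]
      exact H₂.antitone_F (show p ≤ ac.2 + ac.1 by omega) (hξ ac.2 ⟨x, hx, rfl⟩)
    exact hle hZ

/-- The underlying map of the evaluation is `f ⊗ v ↦ f v`. [cite: DeligneHodgeII1971, 1.1.12] -/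
@[simp]
theorem homEval_apply_tmul (f : V →ₗ[ℚ] V') (v : V) :
    (homEval H₁ H₂).toLinearMap (f ⊗ₜ[ℚ] v) = f v :=
  rfl

/-- Evaluating a morphism `φ : H₁ → H₂` (a `(0,0)`-class of `Hom(H₁, H₂)`) is applying it.
[cite: DeligneHodgeII1971, 1.1.12] -/
theorem homEval_apply_homEquivHodgeClasses_tmul (φ : Hom H₁ H₂) (v : V) :
    (homEval H₁ H₂).toLinearMap ((homEquivHodgeClasses H₁ H₂ φ : V →ₗ[ℚ] V') ⊗ₜ[ℚ] v) =
      φ.toLinearMap v :=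
  rfl

/-! ### Composition -/

/-- **The composition `Hom(H₂, H₃) ⊗ Hom(H₁, H₂) → Hom(H₁, H₃)`, `g ⊗ f ↦ g ∘ f`, is a morphism of
mixed Hodge structures** (`W_i Hom ∘ W_k Hom ⊆ W_{i+k} Hom`, `F^a Hom_ℂ ∘ F^c Hom_ℂ ⊆ F^{a+c} Hom_ℂ`;
Deligne, Hodge II, 1.1.12: the constructions are "compatibles à la composition"; the composition
map (1.6.2) of Deligne–Milne, there written `Hom(X,Y) ⊗ Hom(Y,Z) → Hom(X,Z)`).
[cite: DeligneHodgeII1971, 1.1.12] [cite: DeligneMilne1982Tannakian, §1 (1.6.2)] -/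
def homComp : Hom (tensor (hom H₂ H₃) (hom H₁ H₂)) (hom H₁ H₃) where
  toLinearMap := TensorProduct.lift (LinearMap.llcomp ℚ V V' V'')
  map_W_le n := by
    rw [tensor_W, Submodule.map_le_iff_le_comap]
    refine iSup₂_le fun ij (hij : ij.1 + ij.2 = n) ↦ Submodule.map₂_le.2 fun g hg f hf ↦ ?_
    rw [mem_hom_W_iff] at hg hf
    rw [Submodule.mem_comap, TensorProduct.mk_apply, TensorProduct.lift.tmul, LinearMap.llcomp_apply',
      mem_hom_W_iff]
    intro m
    rw [Submodule.map_comp]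
    exact ((Submodule.map_mono (hf m)).trans (hg (m + ij.2))).trans
      (H₃.monotone_W (show m + ij.2 + ij.1 ≤ m + n by omega))
  map_F_le p := by
    rw [tensor_F, Submodule.map_le_iff_le_comap]
    refine iSup₂_le fun ac (hac : ac.1 + ac.2 = p) ↦ fun Z hZ ↦ ?_
    rw [Submodule.mem_comap] at hZ
    rw [Submodule.mem_comap, hom_F_eq_comap_homF, Submodule.mem_comap, homBaseChange_comp_baseChange]
    have hle : Submodule.map₂ (TensorProduct.mk ℂ (ℂ ⊗[ℚ] (V' →ₗ[ℚ] V'')) (ℂ ⊗[ℚ] (V →ₗ[ℚ] V')))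
        ((hom H₂ H₃).F ac.1) ((hom H₁ H₂).F ac.2) ≤ (homF H₁ H₃ p).comap
          (TensorProduct.lift (LinearMap.llcomp ℂ (ℂ ⊗[ℚ] V) (ℂ ⊗[ℚ] V') (ℂ ⊗[ℚ] V'')) ∘ₗ
            TensorProduct.map (homBaseChange V' V'') (homBaseChange V V')) := by
      refine Submodule.map₂_le.2 fun ξ hξ η hη ↦ ?_
      rw [mem_hom_F_iff] at hξ hη
      rw [Submodule.mem_comap, TensorProduct.mk_apply, LinearMap.comp_apply, TensorProduct.map_tmul,
        TensorProduct.lift.tmul, LinearMap.llcomp_apply', mem_homF_iff]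
      intro m
      rw [Submodule.map_comp]
      exact ((Submodule.map_mono (hη m)).trans (hξ (m + ac.2))).trans
        (H₃.antitone_F (show m + p ≤ m + ac.2 + ac.1 by omega))
    exact hle hZ

/-- The underlying map of the composition morphism is `g ⊗ f ↦ g ∘ f`. [cite: DeligneHodgeII1971, 1.1.12] -/
@[simp]
theorem homComp_apply_tmul (g : V' →ₗ[ℚ] V'') (f : V →ₗ[ℚ] V') :
    (homComp H₁ H₂ H₃).toLinearMap (g ⊗ₜ[ℚ] f) = g ∘ₗ f :=
  rfl

/-- Composition then evaluation is iterated evaluation: `ev((g ∘ f) ⊗ v) = ev(g ⊗ ev(f ⊗ v))`.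
[cite: DeligneHodgeII1971, 1.1.12] -/
theorem homEval_homComp_tmul (g : V' →ₗ[ℚ] V'') (f : V →ₗ[ℚ] V') (v : V) :
    (homEval H₁ H₃).toLinearMap ((homComp H₁ H₂ H₃).toLinearMap (g ⊗ₜ[ℚ] f) ⊗ₜ[ℚ] v) =
      (homEval H₂ H₃).toLinearMap (g ⊗ₜ[ℚ] (homEval H₁ H₂).toLinearMap (f ⊗ₜ[ℚ] v)) :=
  rfl


/-! ### The tensor–Hom adjunction -/

variable {T : Type*} [AddCommGroup T] [Module ℚ T] [FiniteDimensional ℚ T] {K : MixedHodgeStructure T}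

/-- **Currying**: a morphism `g : T ⊗ H₁ → H₂` of MHS defines the morphism `T → Hom(H₁, H₂)`,
`t ↦ (v ↦ g(t ⊗ v))` — for `t ∈ W_k T`, `g(t ⊗ W_n H₁) ⊆ g(W_{k+n}(T ⊗ H₁)) ⊆ W_{n+k} H₂`, i.e.
`g(t ⊗ ·) ∈ W_k Hom(H₁, H₂)` by `mem_hom_W_iff`, and likewise for `F` (Deligne–Milne Def. 1.6: the
internal Hom represents `T ↦ Hom(T ⊗ X, Y)`; Deligne, Hodge II, 1.1.12).
[cite: DeligneMilne1982Tannakian, §1 Def. 1.6] [cite: DeligneHodgeII1971, 1.1.12] -/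
def curryHom (g : Hom (tensor K H₁) H₂) : Hom K (hom H₁ H₂) where
  toLinearMap := TensorProduct.curry g.toLinearMap
  map_W_le k := by
    rintro _ ⟨t, ht, rfl⟩
    rw [mem_hom_W_iff]
    rintro n _ ⟨v, hv, rfl⟩
    rw [TensorProduct.curry_apply]
    refine H₂.monotone_W (show k + n ≤ n + k by omega) (g.map_W_le (k + n) ⟨t ⊗ₜ v, ?_, rfl⟩)
    rw [tensor_W]
    exact Submodule.mem_iSup_of_mem (k, n) (Submodule.mem_iSup_of_mem rfl
      (Submodule.apply_mem_map₂ _ ht hv))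
  map_F_le a := by
    rintro _ ⟨τ, hτ, rfl⟩
    rw [mem_hom_F_iff]
    rintro c _ ⟨x, hx, rfl⟩
    rw [homBaseChange_curry_baseChange]
    refine H₂.antitone_F (show c + a ≤ a + c by omega) (g.map_F_le (a + c) ⟨_, ?_, rfl⟩)
    rw [tensor_F]
    refine Submodule.mem_iSup_of_mem (a, c) (Submodule.mem_iSup_of_mem rfl ?_)
    rw [Submodule.mem_comap, LinearEquiv.coe_coe, LinearEquiv.apply_symm_apply]
    exact Submodule.apply_mem_map₂ _ hτ hx

/-- The underlying map of `curryHom g` is `t ↦ (v ↦ g(t ⊗ v))`. [cite: DeligneMilne1982Tannakian, §1 Def. 1.6] -/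
@[simp]
theorem curryHom_toLinearMap_apply (g : Hom (tensor K H₁) H₂) (t : T) (v : V) :
    (curryHom H₁ H₂ g).toLinearMap t v = g.toLinearMap (t ⊗ₜ[ℚ] v) :=
  rfl

/-- **Uncurrying**: a morphism `f : T → Hom(H₁, H₂)` defines `ev ∘ (f ⊗ id) : T ⊗ H₁ → H₂`,
`t ⊗ v ↦ f(t)(v)` (Deligne–Milne Def. 1.6: "to a `g` there corresponds a unique `f` such that
`ev ∘ (f ⊗ id) = g`"). [cite: DeligneMilne1982Tannakian, §1 Def. 1.6] -/
def uncurryHom (f : Hom K (hom H₁ H₂)) : Hom (tensor K H₁) H₂ :=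
  (homEval H₁ H₂).comp (f.tensorMap (Hom.id H₁))

/-- The underlying map of `uncurryHom f` is `t ⊗ v ↦ f(t)(v)`. [cite: DeligneMilne1982Tannakian, §1 Def. 1.6] -/
@[simp]
theorem uncurryHom_toLinearMap_apply_tmul (f : Hom K (hom H₁ H₂)) (t : T) (v : V) :
    (uncurryHom H₁ H₂ f).toLinearMap (t ⊗ₜ[ℚ] v) = f.toLinearMap t v :=
  rfl

/-- **The tensor–Hom adjunction `Hom_MHS(T ⊗ H₁, H₂) ≃ Hom_MHS(T, Hom(H₁, H₂))`**: the internal Hom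
`MixedHodgeStructure.hom H₁ H₂` represents the functor `T ↦ Hom_MHS(T ⊗ H₁, H₂)` on mixed Hodge
structures (Deligne–Milne, Def. 1.6 and (1.6.3); with `T = ℚ(0)` and the unit isomorphism this is
(1.6.4) `Hom(1, Hom(X, Y)) = Hom(X, Y)`, cf. `homEquivHodgeClasses`).
[cite: DeligneMilne1982Tannakian, §1 Def. 1.6 and (1.6.3)] -/
def tensorHomEquiv : Hom (tensor K H₁) H₂ ≃ Hom K (hom H₁ H₂) where
  toFun := curryHom H₁ H₂
  invFun := uncurryHom H₁ H₂
  left_inv _ := Hom.ext (TensorProduct.ext' fun _ _ ↦ rfl)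
  right_inv _ := Hom.ext (LinearMap.ext fun _ ↦ LinearMap.ext fun _ ↦ rfl)

/-- `ev ∘ (curry g ⊗ id) = g`. [cite: DeligneMilne1982Tannakian, §1 Def. 1.6] -/
theorem uncurryHom_curryHom (g : Hom (tensor K H₁) H₂) : uncurryHom H₁ H₂ (curryHom H₁ H₂ g) = g :=
  (tensorHomEquiv H₁ H₂).left_inv g

/-- `curry (ev ∘ (f ⊗ id)) = f`. [cite: DeligneMilne1982Tannakian, §1 Def. 1.6] -/
theorem curryHom_uncurryHom (f : Hom K (hom H₁ H₂)) : curryHom H₁ H₂ (uncurryHom H₁ H₂ f) = f :=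
  (tensorHomEquiv H₁ H₂).right_inv f

/-- The evaluation is the uncurrying of the identity of `Hom(H₁, H₂)` (Def. 1.6: `ev` "the morphism
corresponding to `id_{Hom(X,Y)}`"). [cite: DeligneMilne1982Tannakian, §1 Def. 1.6] -/
theorem uncurryHom_id : uncurryHom H₁ H₂ (Hom.id (hom H₁ H₂)) = homEval H₁ H₂ :=
  Hom.ext (TensorProduct.ext' fun _ _ ↦ rfl)

/-! ### The duality pairing -/

/-- **The duality pairing `H^∨ ⊗ H → ℚ(0)`, `φ ⊗ v ↦ φ(v)`, is a morphism of mixed Hodge structures**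
with values in the unit object `ℚ(0)` (`W_{-1} ℚ(0) = 0`, `W_0 = ℚ`; `F⁰ = ℂ`, `F¹ = 0`): on
`W_i(H^∨) ⊗ W_k(H) = (W_{-i-1} H)^⊥ ⊗ W_k H` the pairing vanishes when `i + k < 0` (then
`W_k ⊆ W_{-i-1}`), and on `F^a(H^∨) ⊗ F^c = (F^{1-a})^⊥ ⊗ F^c` it vanishes when `a + c > 0` (then
`F^c ⊆ F^{1-a}`) — Deligne, Hodge II, 1.1.6 (the dual filtration) with 1.1.12.
[cite: DeligneHodgeII1971, 1.1.6 and 1.1.12] [cite: CattaniElZeinGriffithsLe2014, Ch. 3 §3.2.2.7 p. 163] -/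
def dualPairing (H : MixedHodgeStructure V) :
    Hom (tensor H.dual H) (HodgeStructure.tate 0).toMixedHodgeStructure where
  toLinearMap := contractLeft ℚ V
  map_W_le n := by
    rw [tensor_W, HodgeStructure.toMixedHodgeStructure_W]
    by_cases hn : -2 * 0 ≤ n
    · rw [HodgeStructure.trivialWeightFiltration_of_le hn]
      exact le_top
    · rw [HodgeStructure.trivialWeightFiltration_of_lt (not_le.1 hn), Submodule.map_le_iff_le_comap,
        Submodule.comap_bot]
      refine iSup₂_le fun ij (hij : ij.1 + ij.2 = n) ↦ Submodule.map₂_le.2 fun φ hφ v hv ↦ ?_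
      rw [dual_W, Submodule.mem_dualAnnihilator] at hφ
      rw [LinearMap.mem_ker, TensorProduct.mk_apply, contractLeft_apply]
      exact hφ v (H.monotone_W (show ij.2 ≤ -ij.1 - 1 by omega) hv)
  map_F_le p := by
    rw [tensor_F, HodgeStructure.toMixedHodgeStructure_F, HodgeStructure.tate_F]
    by_cases hp : p ≤ -0
    · rw [HodgeStructure.pureFiltration_of_le hp]
      exact le_top
    · rw [HodgeStructure.pureFiltration_of_lt (not_le.1 hp), Submodule.map_le_iff_le_comap,
        Submodule.comap_bot]
      refine iSup₂_le fun ac (hac : ac.1 + ac.2 = p) ↦ fun Z hZ ↦ ?_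
      rw [Submodule.mem_comap] at hZ
      rw [LinearMap.mem_ker, contractLeft_baseChange]
      have hle : Submodule.map₂ (TensorProduct.mk ℂ (ℂ ⊗[ℚ] Module.Dual ℚ V) (ℂ ⊗[ℚ] V))
          (H.dual.F ac.1) (H.F ac.2) ≤ LinearMap.ker
            (contractLeft ℂ (ℂ ⊗[ℚ] V) ∘ₗ TensorProduct.map (dualBaseChange V) LinearMap.id) := by
        refine Submodule.map₂_le.2 fun ξ hξ x hx ↦ ?_
        rw [dual_F, Submodule.mem_comap, Submodule.mem_dualAnnihilator] at hξ
        rw [LinearMap.mem_ker, TensorProduct.mk_apply, LinearMap.comp_apply, TensorProduct.map_tmul,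
          LinearMap.id_apply, contractLeft_apply]
        exact hξ x (H.antitone_F (show 1 - ac.1 ≤ ac.2 by omega) hx)
      have h0 := hle hZ
      rw [LinearMap.mem_ker, LinearMap.comp_apply, LinearEquiv.coe_coe] at h0
      rw [h0, map_zero]

/-- The underlying map of the duality pairing is `φ ⊗ v ↦ φ v` (Mathlib's `contractLeft`).
[cite: DeligneHodgeII1971, 1.1.6 and 1.1.12] -/
@[simp]
theorem dualPairing_apply_tmul (H : MixedHodgeStructure V) (φ : Module.Dual ℚ V) (v : V) :
    (dualPairing H).toLinearMap (φ ⊗ₜ[ℚ] v) = φ v :=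
  rfl

end MixedHodgeStructure

end Literature.AlgebraicGeometry.Motives

end
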